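import Literature.Barriers.CriticalPhenomena.LongRangeTrivialityOnZ3InfraredBoundFourier
import Literature.Barriers.CriticalPhenomena.LongRangeTrivialityOnZ3InputsProofs

/-!
# The infrared bound in `d ≤ 2` (Panis 2023, Remark 3.9) — and in every `d` — from Proposition 3.7
# with the Fröhlich–Simon–Spencer constant: one Fejér-kernel argument for all four vendored
# infrared facts

Sibling of `Literature/Barriers/CriticalPhenomena/LongRangeTrivialityOnZ3InfraredBoundFourier.lean`
(barrier catalogue D-0021, sub-problem `Ising3DConformalLimit`), first layer under the named fact
`Literature.Barriers.CriticalPhenomena.panis_infraredBound_algebraic_lowDim` of `…InputsProofs.lean` —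
Panis, *Triviality of the scaling limits of critical Ising and `φ⁴` models with effective dimension at
least four*, arXiv:2309.05797 = Ann. Probab. 54 (2026), §3.3, first display of p. 16 ("for algebraic
decay interactions, `⟨τ₀τ_x⟩_{ρ,β} ≤ C/(β|J|)·|x|^{-(d-α)}`, `α ∈ (0,2)`") **with Remark 3.9** ("The above
bound is also valid for `d = 2` in the case `α ∈ (0,2)` and for `d = 1` with `α ∈ (0,1)`, since in both
cases `|p|^{-α}` is locally integrable").

## What is proved

The previous layer (`…InfraredBoundFourier`) proved Proposition 3.8's first display, hence
`panis_infraredBound_algebraic` (`d ≥ 3`), from Proposition 3.7 + the ABF summability + MMS2, with the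
integrability of the infrared majorant `1/(1-Ĵ(k))` on the Brillouin zone taken from `1-Ĵ(k) ≥ c₁‖k‖²`
and `d ≥ 3`. Remark 3.9 is exactly the observation that for `α < 2` the majorant is `≲ ‖k‖^{-α}`, locally
integrable as soon as `α < d`. This file runs the SAME Fejér-kernel argument once, in every dimension
`d ≥ 1`, parametrised by a cube gap bound `1 - Ĵ(q) ≥ c'‖q‖^a` with `a < d` (all PROVED):

* `LongRangeIsing.integrableOn_norm_rpow_neg` (`‖k‖^{-a} ∈ L¹((-π,π]^d)` for `a < d`, Mathlib's
  `integrableOn_ball_of_norm_le_rpow`), `LongRangeIsing.integrableOn_inv_gap_of_gap`;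
* `LongRangeIsing.sum_sum_pairCorrelation_le_of_gap` — Gaussian domination of the Fejér-weighted double
  sum `∑_{x,y∈Λ_L}S_β(x-y) ≤ (9π²)^d/(2π)^d · L^d/(β|J|) ∫_{(-πL,πL]^d}W(u)/(1-Ĵ(u/L))du` for
  `0 < β < β_c`, every `d ≥ 1` (Parseval for the Fejér weight, the bound on `Ŝ_β` off the null
  hyperplane `k₀ = 0`, the envelope `‖B_L(k)‖² ≤ (9π²)^dL^{2d}W(Lk)`, the substitution `u = Lk` — the
  proof of `…InfraredBoundFourier`'s `sum_sum_pairCorrelation_le` verbatim, with the general majorant);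
* `LongRangeIsing.kernelIntegral_le_of_gap` — `∫_{(-πn,πn]^d}W(u)/(1-Ĵ(u/n))du ≤ (n^a/c')∫_{ℝ^d}W(u)‖u‖^{-a}du`
  (`0 ≤ a < d`; `div_gap_le` and `integrable_envelopeRiesz` of `…InfraredBound`);
* `pairCorrelation_le_kernelIntegral_of_gap` — Proposition 3.8's first display (kernel form) in every
  `d ≥ 1`, for `0 < β ≤ β_c` (MMS2 averaged over `Λ_m`, `m = ⌊n/(2d)⌋`, `n = |x|_∞`;
  `|Λ_m|χ_m ≤ ∑_{Λ_n²}S(x-y)`; the count `(n/(2d))^d ≤ |Λ_m|`; and `β = β_c` by the left-continuity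
  `tendsto_pairCorrelation_nhdsLT` of `…LeftContinuity`);
* `pairCorrelation_le_rpow_of_gap` — `⟨σ₀σ_x⟩_β ≤ C/(β|x|^{d-a})` for `0 < β ≤ β_c`, `x ≠ 0`, granted a
  cube gap bound with exponent `0 ≤ a < d`;
* HEADLINES. With `a = α` (`α < 2`: the discharged gap bound `exists_cube_gap_lower` of `…InfraredBound`)
  in `d = 2`, `α < 2` and `d = 1`, `α < 1`:
  **`panis_infraredBound_algebraic_lowDim_of_prop37 : panis_prop37_infraredBound_fss →
  abf_pairCorrelation_summable → panis_infraredBound_algebraic_lowDim`** (MMS2 being the tree's theorem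
  `panis_mms_two_point_monotone_holds`), and `…_of_prop37'` from the tree's printed-constant fact
  `panis_prop37_infraredBound`. By-products of the same theorem, from the same two inputs:
  `panis_prop38_kernelForm_of_prop37_fss` (`d ≥ 3`, `a = 2`), `panis_infraredBound_algebraic_of_prop37_fss`
  (`d ≥ 3`, `α ≠ 2`, `a = α∧2`), `panis_infraredBound_rp_of_prop37_fss` (Proposition 3.8 (IRB), `d ≥ 3`,
  every `α`, `a = 2`, then `S_β ≤ S_{β_c}` by Griffiths), whence `panis_ursellFourBoxSum_le` and Theorem
  1.2 in every `d ≥ 1` from the tree diagram bound, the moment display and these two inputs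
  (`panis_ursellFourBoxSum_le_of_prop37_fss`, `panis_thm12_of_prop37_fss`).

## The constant of Proposition 3.7 (why a second named fact)

Proposition 3.4 / 3.7 are PRINTED with the bound `1/(2β|J|(1-Ĵ(p)))`, `|J|(1-Ĵ(p)) = ∑_x(1-cos p·x)J_{0,x}`
(Remark 3.5), for the Hamiltonian `-∑_{{x,y}}J_{x,y}τ_xτ_y` of §1.2.1, and `…InfraredBoundFourier` vendors
Proposition 3.7 verbatim (`panis_prop37_infraredBound`). The Gaussian-domination constant of
Fröhlich–Simon–Spencer / Fröhlich–Israel–Lieb–Simon is, in this normalisation, `1/(β|J|(1-Ĵ(p)))`: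
Friedli–Velenik 2017, Thm. 10.24 (p. 502) print `∑_je^{ip·j}⟨S₀·S_j⟩ ≤ (ν/4βd){1-(2d)⁻¹∑_{j∼0}cos(p·j)}⁻¹`
for the Hamiltonian (10.38) `β∑_{{i,j}}‖S_i-S_j‖²` (p. 499), i.e. `-2βS_i·S_j` per bond, which at `ν = 1`
and in the once-per-bond convention `β' = 2β` reads `Ŝ(p) ≤ 1/(β'∑_{j∼0}(1-cos p·j)) = 1/(β'|J|(1-Ĵ(p)))`;
this is the constant of the tree's PROVED nearest-neighbour torus bound
`Literature.Probability.LatticeModels.infraredBound` (`Ĝ_L(p) ≤ 1/(2β∑ᵢ(1-cos pᵢ))`,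
`GaussianDominationProofs.lean`), and `LroInfraredBound.lean` records the same factor-`2` slip in
Aizenman–Duminil-Copin–Sidoravicius 2015, (3.13), which Panis's §3.3 follows. The printed constant is
too strong in the generality stated (reflection-positive `J` with (A1)–(A5); Proposition 3.4 is claimed for
every even `L ≥ 2`): for the nearest-neighbour chain (`d = 1`, example (i) of §3.1, `|J| = 2`,
`|J|(1-Ĵ(π)) = 4`) the periodised coupling on `𝕋₂ = ℤ/2ℤ` is `J⁽²⁾_{0,1} = 2`, so `⟨τ₀τ₁⟩_{𝕋₂,β} = tanh 2β`
and at `β = 1/4`, `p = π`: `Ŝ⁽²⁾(π) = 1 - tanh(1/2) = 2/(e+1) ≈ 0.538 > 1/2 = 1/(2β|J|(1-Ĵ(π)))` (a four-term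
computation; `e < 3`); likewise on `ℤ/4ℤ` at `β = 1/2`: `Ŝ⁽⁴⁾(π) = 4(1+e⁻²)/(e²+6+e⁻²) ≈ 0.336 > 1/4`, and for
the infinite chain `Ŝ(π) = e^{-2β}`, `e⁻¹ > 1/4`; in all three cases `1/(β|J|(1-Ĵ(π)))` holds. We therefore vendor Proposition 3.7 a second
time, `panis_prop37_infraredBound_fss`, with the Fröhlich–Simon–Spencer constant — WEAKER than the printed
statement (`panis_prop37_infraredBound_fss_of_printed`, PROVED) and the statement that the torus Gaussian
domination actually yields — and run every reduction from it; the primed headlines keep the tree's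
printed-constant fact usable. Constants downstream are existential, so nothing else changes.

## References

* R. Panis, arXiv:2309.05797 (2023) = Ann. Probab. 54 (2026): §1.2.1 (Hamiltonian, (A1)–(A5)), §3.1
  (examples (i), (iii)), Prop. 3.4, Remark 3.5, Prop. 3.7, Prop. 3.8 and its proof, the two displays
  before Remark 3.9, Remark 3.9, §3.6 (last display of p. 16) [Panis2023Triviality] (held as TeX-derived
  text `paper:arxiv-2309.05797`, pp. 5, 13–16 read).
* S. Friedli, Y. Velenik, *Statistical Mechanics of Lattice Systems*, CUP (2017), §10.5.2, (10.38)
  (p. 499), Thm. 10.24 (p. 502), Prop. 10.27 (p. 503) [FriedliVelenik2017] (held, pp. 499–507 read).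
* M. Aizenman, D. J. Barsky, R. Fernández, J. Stat. Phys. 47 (1987) 343–374 [AizenmanBarskyFernandezJSP1987]
  (as cited by Panis, §3.3; not consulted).
* Mathlib: `integrableOn_ball_of_norm_le_rpow`, `MeasureTheory.Measure.setIntegral_comp_smul_of_pos`,
  `Measure.univ_pi_Ioc_ae_eq_Icc`, `Measure.ae_eval_ne`.
-/

noncomputable section

namespace Literature.Barriers.CriticalPhenomena

open Literature.Probability.LatticeModels Literature.Probability.Percolation Filter Topology Finset
open _root_.MeasureTheory _root_.Set Complex
open scoped symmDiff Real Pointwise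

open LongRangeIsing

/-! ### Proposition 3.7 with the Fröhlich–Simon–Spencer constant (named fact) -/

/-- NAMED FACT — **Panis 2023, Proposition 3.7 (the infrared bound in infinite volume below `β_c`),
with the Fröhlich–Simon–Spencer / Friedli–Velenik constant, for `J_{x,y} = C₀|x-y|₁^{-d-α}`.**
"Let `β < β_c(ρ)`. Let `p ∈ (-π,π]^d`. Then `Ŝ_{ρ,β}(p) ≤ 1/(2β|J|(1 - Ĵ(p)))`" is the printed statement
(vendored verbatim as `panis_prop37_infraredBound` in `…InfraredBoundFourier`); HERE the right-hand side
is `1/(β|J|(1 - Ĵ(p)))`, the constant that the torus Gaussian domination gives for the Hamiltonian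
`-∑_{{x,y}}J_{x,y}τ_xτ_y` of §1.2.1 (Friedli–Velenik 2017, Thm. 10.24 for the Hamiltonian (10.38)
`β∑_{{i,j}}‖S_i-S_j‖²`, i.e. `-2βS_i·S_j` per bond: `Ŝ(p) ≤ (ν/4βd){1-(2d)⁻¹∑_{j∼0}cos(p·j)}⁻¹`, which is
`1/(β'|J|(1-Ĵ(p)))` at `β' = 2β`, `ν = 1`; the tree's proved nearest-neighbour
`Literature.Probability.LatticeModels.infraredBound` has this constant). The printed `2β` is a slip
inherited from Aizenman–Duminil-Copin–Sidoravicius 2015, (3.13) (see `LroInfraredBound.lean`): for the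
nearest-neighbour chain on `𝕋₂ = ℤ/2ℤ` (`J⁽²⁾_{0,1} = 2`) at `β = 1/4`, `p = π` one has
`Ŝ⁽²⁾(π) = 1 - tanh(1/2) = 2/(e+1) > 1/2 = 1/(2β|J|(1-Ĵ(π)))` (see the module docstring). So this
fact is WEAKER than the printed Proposition 3.7 (`panis_prop37_infraredBound_fss_of_printed`) and is the
honest target of a proof of Proposition 3.7 (torus Gaussian domination for the periodised couplings, the
uniqueness of the state and `∑_xS_β(x) < ∞` below `β_c`, Simon–Lieb). Vendored for the algebraically
decaying family (`d ≥ 1`), `0 < β < β_c`, `Ŝ_β` in the real form `twoPointFourier`, `Ĵ` the real form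
`couplingFourier`, `p ∈ (-π,π]^d`, `p ≠ 0` (at `p = 0` the printed right-hand side is `+∞`). In the
no-transition regime (`d = 1`, `α > 1`) the tree's `criticalBeta` is `sInf ∅ = 0` and the fact is vacuous.
Users take `(h : panis_prop37_infraredBound_fss)`.
[cite: Panis2023Triviality, Proposition 3.7] [cite: FriedliVelenik2017, Thm. 10.24 (p. 502) with (10.38) (p. 499)] -/
def panis_prop37_infraredBound_fss : Prop :=
  ∀ (d : ℕ), 1 ≤ d → ∀ (C₀ α : ℝ), 0 < C₀ → 0 < α →
    ∀ (β : ℝ), 0 < β → β < LongRangeIsing.criticalBeta (algebraicCoupling d C₀ α) →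
      ∀ p ∈ momentumBox d 1, p ≠ 0 →
        twoPointFourier (algebraicCoupling d C₀ α) β p ≤
          1 / (β * couplingNorm (algebraicCoupling d C₀ α) *
            (1 - couplingFourier (algebraicCoupling d C₀ α) p))

/-- **The printed Proposition 3.7 implies its Fröhlich–Simon–Spencer form** (`1/(2D) ≤ 1/D` for
`D = β|J|(1-Ĵ(p)) ≥ 0`; both sides vanish in Lean when `D = 0`). [cite: Panis2023Triviality, Proposition 3.7] -/
theorem panis_prop37_infraredBound_fss_of_printed (h : panis_prop37_infraredBound) :
    panis_prop37_infraredBound_fss := by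
  intro d hd C₀ α hC₀ hα β hβ hβc p hp hp0
  refine (h d hd C₀ α hC₀ hα β hβ hβc p hp hp0).trans ?_
  set J := algebraicCoupling d C₀ α with hJdef
  have hpos := couplingNorm_algebraic_pos hd hC₀ hα
  have hs := algebraicCoupling_zero_summable hd hC₀.le hα
  have hJ0 : ∀ y, 0 ≤ J 0 y := fun y => algebraicCoupling_nonneg hC₀.le α 0 y
  have hD : 0 ≤ β * couplingNorm J * (1 - couplingFourier J p) :=
    mul_nonneg (mul_nonneg hβ.le hpos.le) (one_sub_couplingFourier_nonneg J hJ0 hs hpos p)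
  rcases hD.lt_or_eq with hDpos | hD0
  · rw [show 2 * β * couplingNorm J * (1 - couplingFourier J p) =
        2 * (β * couplingNorm J * (1 - couplingFourier J p)) by ring]
    exact one_div_le_one_div_of_le hDpos (by linarith)
  · rw [← hD0, show 2 * β * couplingNorm J * (1 - couplingFourier J p) =
        2 * (β * couplingNorm J * (1 - couplingFourier J p)) by ring, ← hD0]
    simp

namespace LongRangeIsing

variable {d : ℕ}

/-! ### The infrared majorant `‖k‖^{-a}`, `a < d`, on the Brillouin zone -/

section Majorant

/-- **`‖k‖^{-a}` is integrable on `(-π,π]^d` for `a < d`** (`d ≥ 1`; local integrability of `‖k‖^{-a}` in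
`ℝ^d` — the content of Remark 3.9: "`|p|^{-α}` is locally integrable"). [cite: Panis2023Triviality, Remark 3.9] -/
theorem integrableOn_norm_rpow_neg (hd : 1 ≤ d) {a : ℝ} (had : a < d) :
    IntegrableOn (fun k : Fin d → ℝ => ‖k‖ ^ (-a)) (momentumBox d 1) := by
  have h : IntegrableOn (fun k : Fin d → ℝ => ‖k‖ ^ (-a)) (Metric.ball 0 (Real.pi + 1)) := by
    refine integrableOn_ball_of_norm_le_rpow (μ := volume) (C := 1) (α := a) (r := Real.pi + 1) ?_ ?_
      (ae_of_all _ fun k => by rw [Real.norm_eq_abs, abs_of_nonneg (Real.rpow_nonneg (norm_nonneg _) _), one_mul])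
      (measurable_norm.pow_const _).aestronglyMeasurable
    · rw [Module.finrank_fin_fun]; exact hd
    · rw [Module.finrank_fin_fun]; exact had
  refine h.mono_set fun k hk => ?_
  rw [Metric.mem_ball, dist_zero_right]
  linarith [norm_le_pi_of_mem_momentumBox_one hk]

variable {C₀ α : ℝ}

/-- **The infrared majorant is integrable on the Brillouin zone, granted a cube gap bound with exponent
`a < d`**: if `1 - Ĵ(q) ≥ c'‖q‖^a` on `‖q‖_∞ ≤ π` then `1/(1 - Ĵ(k)) ≤ ‖k‖^{-a}/c' ∈ L¹((-π,π]^d)`.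
[cite: Panis2023Triviality, Remark 3.9 ("since in both cases |p|^{-α} is locally integrable")] -/
theorem integrableOn_inv_gap_of_gap (hd : 1 ≤ d) (hC₀ : 0 < C₀) (hα : 0 < α) {a c' : ℝ} (had : a < d)
    (hc' : 0 < c')
    (hgap : ∀ q : Fin d → ℝ, ‖q‖ ≤ Real.pi → c' * ‖q‖ ^ a ≤ 1 - couplingFourier (algebraicCoupling d C₀ α) q) :
    IntegrableOn (fun k : Fin d → ℝ => 1 / (1 - couplingFourier (algebraicCoupling d C₀ α) k))
      (momentumBox d 1) := by
  set J := algebraicCoupling d C₀ α with hJdef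
  have hpos := couplingNorm_algebraic_pos hd hC₀ hα
  have hs := algebraicCoupling_zero_summable hd hC₀.le hα
  have hJ0 : ∀ y, 0 ≤ J 0 y := fun y => algebraicCoupling_nonneg hC₀.le α 0 y
  refine Integrable.mono' ((integrableOn_norm_rpow_neg hd had).const_mul (1 / c')) ?_ ?_
  · exact (measurable_const.div (measurable_const.sub (continuous_couplingFourier J hJ0 hs).measurable)).aestronglyMeasurable
  · refine (ae_restrict_iff' (measurableSet_momentumBox 1)).2 (ae_of_all _ fun k hk => ?_)
    have hD := one_sub_couplingFourier_nonneg J hJ0 hs hpos k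
    rw [Real.norm_eq_abs, abs_of_nonneg (div_nonneg zero_le_one hD)]
    by_cases hk0 : k = 0
    · subst hk0
      rw [couplingFourier_zero J hpos.ne', sub_self, div_zero]
      exact mul_nonneg (by positivity) (Real.rpow_nonneg (norm_nonneg _) _)
    · have hkπ := norm_le_pi_of_mem_momentumBox_one hk
      have hq0 : 0 < ‖k‖ := norm_pos_iff.2 hk0
      have h1 := hgap k hkπ
      have h2 : 0 < c' * ‖k‖ ^ a := mul_pos hc' (Real.rpow_pos_of_pos hq0 _)
      calc 1 / (1 - couplingFourier J k) ≤ 1 / (c' * ‖k‖ ^ a) := div_le_div_of_nonneg_left zero_le_one h2 h1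
        _ = 1 / c' * ‖k‖ ^ (-a) := by
            rw [Real.rpow_neg (norm_nonneg _)]; field_simp

end Majorant

/-! ### Gaussian domination of the Fejér-weighted double sum, every `d ≥ 1` -/

section DoubleSum

variable {C₀ α : ℝ}

/-- **Gaussian domination of the Fejér-weighted double sum in every dimension** (`0 < β < β_c`, `L ≥ 1`,
`d ≥ 1`, a cube gap bound with exponent `a < d` for the integrability of the majorant): from Parseval,
Proposition 3.7 (Fröhlich–Simon–Spencer constant) and the Fejér envelope,
`∑_{x,y∈Λ_L} S_β(x-y) ≤ (9π²)^d/(2π)^d · L^d/(β|J|) ∫_{(-πL,πL]^d} W(u)/(1 - Ĵ(u/L)) du`.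
[cite: Panis2023Triviality, proof of Proposition 3.8 (χ̃_L ≤ C₃L^d∫e^{-L²‖p‖²}Ŝ(p)dp, "with the change of variable u = pL, and Proposition 3.7") and Remark 3.9] -/
theorem sum_sum_pairCorrelation_le_of_gap (h37 : panis_prop37_infraredBound_fss)
    (habf : abf_pairCorrelation_summable) (hd : 1 ≤ d) (hC₀ : 0 < C₀) (hα : 0 < α)
    {a c' : ℝ} (had : a < d) (hc' : 0 < c')
    (hgap : ∀ q : Fin d → ℝ, ‖q‖ ≤ Real.pi → c' * ‖q‖ ^ a ≤ 1 - couplingFourier (algebraicCoupling d C₀ α) q)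
    {β : ℝ} (hβ : 0 < β) (hβc : β < LongRangeIsing.criticalBeta (algebraicCoupling d C₀ α)) {L : ℕ} (hL : 1 ≤ L) :
    ∑ x ∈ box d L, ∑ y ∈ box d L, pairCorrelation (algebraicCoupling d C₀ α) β 0 (x - y) ≤
      (9 * Real.pi ^ 2) ^ d / (2 * Real.pi) ^ d * ((L : ℝ) ^ d / (β * couplingNorm (algebraicCoupling d C₀ α))) *
        ∫ u in momentumBox d L, envelope d u / (1 - couplingFourier (algebraicCoupling d C₀ α) (fun i => u i / L)) := by
  set J := algebraicCoupling d C₀ α with hJdef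
  have hpos := couplingNorm_algebraic_pos hd hC₀ hα
  have hsJ := algebraicCoupling_zero_summable hd hC₀.le hα
  have hJ0 : ∀ y, 0 ≤ J 0 y := fun y => algebraicCoupling_nonneg hC₀.le α 0 y
  have hJnn : ∀ x y, 0 ≤ J x y := algebraicCoupling_nonneg hC₀.le α
  set S : Site d → ℝ := fun x => pairCorrelation J β 0 x with hSdef
  have hS0 : ∀ x, 0 ≤ S x := fun x => pairCorrelation_nonneg J β hβ.le hJnn 0 x
  have hSs : Summable fun x => |S x| :=
    (habf d hd C₀ α hC₀ hα β hβ hβc).congr fun x => (abs_of_nonneg (hS0 x)).symm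
  have hL0 : (0 : ℝ) < L := by exact_mod_cast hL
  -- Parseval
  have hpar := sum_sum_eq_integral_normSq_mul_re_siteFT hSs L
  have hre : ∀ k, (siteFT S k).re = twoPointFourier J β k := fun k =>
    re_siteFT_pairCorrelation hβ.le hJnn (habf d hd C₀ α hC₀ hα β hβ hβc) k
  simp_rw [hre] at hpar
  rw [← volume_restrict_momentumCube] at hpar
  -- pass to the half-open zone `(-π,π]^d`
  have hae : (momentumBox d 1 : Set (Fin d → ℝ)) =ᵐ[volume] momentumCube d := by
    rw [MeasureTheory.volume_pi, momentumBox, momentumCube]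
    have := Measure.univ_pi_Ioc_ae_eq_Icc (μ := fun _ : Fin d => (volume : Measure ℝ))
      (f := fun _ => -(Real.pi * 1)) (g := fun _ => Real.pi * 1)
    rw [← Set.pi_univ_Icc] at this
    simpa only [mul_one] using this
  rw [← setIntegral_congr_set hae] at hpar
  -- the majorant
  set B : ℝ := β * couplingNorm J with hBdef
  have hB : 0 < B := by positivity
  set M : (Fin d → ℝ) → ℝ := fun k =>
    (9 * Real.pi ^ 2) ^ d * (L : ℝ) ^ (2 * d) * envelope d ((L : ℝ) • k) * (1 / (B * (1 - couplingFourier J k)))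
    with hMdef
  have hgap0 : ∀ k, 0 ≤ 1 - couplingFourier J k := fun k => one_sub_couplingFourier_nonneg J hJ0 hsJ hpos k
  -- integrability of the majorant on the zone
  have hIg := integrableOn_inv_gap_of_gap hd hC₀ hα had hc' hgap
  have hMint : IntegrableOn M (momentumBox d 1) := by
    have h1 : IntegrableOn (fun k => (9 * Real.pi ^ 2) ^ d * (L : ℝ) ^ (2 * d) * (1 / B) *
        (1 / (1 - couplingFourier J k))) (momentumBox d 1) := hIg.const_mul _
    refine Integrable.mono' h1 ?_ ?_
    · refine ((continuous_const.mul (continuous_envelope.comp (continuous_const_smul (L : ℝ)))).measurable.mul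
        (measurable_const.div (measurable_const.mul (measurable_const.sub
          (continuous_couplingFourier J hJ0 hsJ).measurable)))).aestronglyMeasurable
    · refine ae_of_all _ fun k => ?_
      have hE0 := envelope_nonneg ((L : ℝ) • k)
      have hE1 := envelope_le_one ((L : ℝ) • k)
      have hq : 0 ≤ 1 / (B * (1 - couplingFourier J k)) := div_nonneg zero_le_one (mul_nonneg hB.le (hgap0 k))
      rw [Real.norm_eq_abs, hMdef, abs_of_nonneg (mul_nonneg (by positivity) hq)]
      have : 1 / (B * (1 - couplingFourier J k)) = 1 / B * (1 / (1 - couplingFourier J k)) := by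
        rw [one_div_mul_one_div]
      rw [this]
      have hq' : 0 ≤ 1 / (1 - couplingFourier J k) := div_nonneg zero_le_one (hgap0 k)
      calc (9 * Real.pi ^ 2) ^ d * (L : ℝ) ^ (2 * d) * envelope d ((L : ℝ) • k) * (1 / B * (1 / (1 - couplingFourier J k)))
          ≤ (9 * Real.pi ^ 2) ^ d * (L : ℝ) ^ (2 * d) * 1 * (1 / B * (1 / (1 - couplingFourier J k))) := by
            gcongr
        _ = _ := by ring
  -- integrability of the left integrand (bounded and continuous)
  have hSc : Continuous fun k => twoPointFourier J β k := by
    have := (continuous_siteFT hSs)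
    have h2 : Continuous fun k => (siteFT S k).re := Complex.continuous_re.comp this
    simpa only [hre] using h2
  haveI : IsFiniteMeasure ((volume : Measure (Fin d → ℝ)).restrict (momentumBox d 1)) := by
    refine isFiniteMeasure_restrict.2 (ne_of_lt (Bornology.IsBounded.measure_lt_top ?_))
    refine (Metric.isBounded_closedBall (x := (0 : Fin d → ℝ)) (r := Real.pi)).subset fun k hk => ?_
    rw [Metric.mem_closedBall, dist_zero_right]
    exact norm_le_pi_of_mem_momentumBox_one hk
  have hFint : IntegrableOn (fun k => ‖boxCharSum d L k‖ ^ 2 * twoPointFourier J β k) (momentumBox d 1) := by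
    refine Integrable.mono' (integrable_const ((#(box d L) : ℝ) ^ 2 * ∑' x, |S x|)) ?_ (ae_of_all _ fun k => ?_)
    · exact (((continuous_boxCharSum L).norm.pow 2).mul hSc).aestronglyMeasurable
    · rw [Real.norm_eq_abs, abs_mul, abs_of_nonneg (sq_nonneg _)]
      refine mul_le_mul (pow_le_pow_left₀ (norm_nonneg _) (norm_boxCharSum_le L k) 2) ?_ (abs_nonneg _) (sq_nonneg _)
      rw [← hre, ← Real.norm_eq_abs]
      exact (Complex.abs_re_le_norm _).trans (norm_siteFT_le hSs k)
  -- the pointwise (a.e.) bound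
  have hd0 : 0 < d := hd
  have hae2 : ∀ᵐ k ∂(volume.restrict (momentumBox d 1)), ‖boxCharSum d L k‖ ^ 2 * twoPointFourier J β k ≤ M k := by
    have hnull : ∀ᵐ k : Fin d → ℝ ∂volume, k (⟨0, hd0⟩ : Fin d) ≠ (0 : ℝ) := by
      rw [MeasureTheory.volume_pi]
      exact Measure.ae_eval_ne (fun _ => (volume : Measure ℝ)) (⟨0, hd0⟩ : Fin d) 0
    refine (ae_restrict_iff' (measurableSet_momentumBox 1)).2 ?_
    filter_upwards [hnull] with k hk0 hk
    have hkne : k ≠ 0 := fun h => hk0 (by rw [h]; rfl)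
    have hkπ := norm_le_pi_of_mem_momentumBox_one hk
    have h1 := h37 d hd C₀ α hC₀ hα β hβ hβc k hk hkne
    have hq : 0 ≤ 1 / (B * (1 - couplingFourier J k)) := div_nonneg zero_le_one (mul_nonneg hB.le (hgap0 k))
    calc ‖boxCharSum d L k‖ ^ 2 * twoPointFourier J β k
        ≤ ‖boxCharSum d L k‖ ^ 2 * (1 / (B * (1 - couplingFourier J k))) :=
          mul_le_mul_of_nonneg_left h1 (sq_nonneg _)
      _ ≤ (9 * Real.pi ^ 2) ^ d * (L : ℝ) ^ (2 * d) * envelope d ((L : ℝ) • k) * (1 / (B * (1 - couplingFourier J k))) :=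
          mul_le_mul_of_nonneg_right (norm_sum_box_cexp_sq_le hL hkπ) hq
  have hstep1 : ∫ k in momentumBox d 1, ‖boxCharSum d L k‖ ^ 2 * twoPointFourier J β k ≤ ∫ k in momentumBox d 1, M k :=
    integral_mono_ae hFint hMint hae2
  -- the substitution `u = Lk`
  set g : (Fin d → ℝ) → ℝ := fun u => envelope d u / (1 - couplingFourier J (fun i => u i / L)) with hgdef
  have hgL : ∀ k, g ((L : ℝ) • k) = envelope d ((L : ℝ) • k) / (1 - couplingFourier J k) := by
    intro k
    simp only [hgdef, Pi.smul_apply, smul_eq_mul]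
    congr 3
    funext i
    field_simp
  have hsubst : ∫ k in momentumBox d 1, g ((L : ℝ) • k) = ((L : ℝ) ^ d)⁻¹ * ∫ u in momentumBox d L, g u := by
    have := Measure.setIntegral_comp_smul_of_pos (μ := (volume : Measure (Fin d → ℝ))) g (momentumBox d 1) hL0
    rw [smul_momentumBox_one hL0, Module.finrank_fin_fun, smul_eq_mul] at this
    exact this
  have hM_eq : ∀ k, M k = (9 * Real.pi ^ 2) ^ d * (L : ℝ) ^ (2 * d) / B * g ((L : ℝ) • k) := by
    intro k
    rw [hgL, hMdef]
    simp only
    rw [one_div, mul_inv]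
    ring
  have hstep2 : ∫ k in momentumBox d 1, M k =
      (9 * Real.pi ^ 2) ^ d * (L : ℝ) ^ (2 * d) / B * (((L : ℝ) ^ d)⁻¹ * ∫ u in momentumBox d L, g u) := by
    simp_rw [hM_eq]
    rw [integral_const_mul, hsubst]
  -- assemble
  have hπd : (0 : ℝ) < (2 * Real.pi) ^ d := by positivity
  have key : (2 * Real.pi) ^ d * ∑ x ∈ box d L, ∑ y ∈ box d L, S (x - y) ≤
      (9 * Real.pi ^ 2) ^ d * (L : ℝ) ^ (2 * d) / B * (((L : ℝ) ^ d)⁻¹ * ∫ u in momentumBox d L, g u) := by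
    rw [hpar, ← hstep2]; exact hstep1
  have key' := (le_div_iff₀' hπd).2 key
  refine key'.trans (le_of_eq ?_)
  rw [hBdef]
  field_simp
  ring

/-- **The kernel integral under a cube gap bound**: for `n > 0`, `0 ≤ a < d` and `1 - Ĵ(q) ≥ c'‖q‖^a` on
`‖q‖_∞ ≤ π`, `∫_{(-πn,πn]^d} W(u)/(1 - Ĵ(u/n)) du ≤ (n^a/c') ∫_{ℝ^d} W(u)‖u‖^{-a} du` (pointwise
`div_gap_le`, and `W(u)‖u‖^{-a} ∈ L¹(ℝ^d)` by `integrable_envelopeRiesz`). [cite: Panis2023Triviality, proof of Proposition 3.8 (last paragraph: "the observation that 1 - Ĵ(k) ≳ ‖k‖²") and Remark 3.9] -/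
theorem kernelIntegral_le_of_gap (hd : 1 ≤ d) (hC₀ : 0 < C₀) (hα : 0 < α) {a c' : ℝ} (ha0 : 0 ≤ a)
    (had : a < d) (hc' : 0 < c')
    (hgap : ∀ q : Fin d → ℝ, ‖q‖ ≤ Real.pi → c' * ‖q‖ ^ a ≤ 1 - couplingFourier (algebraicCoupling d C₀ α) q)
    {n : ℝ} (hn : 0 < n) :
    ∫ u in momentumBox d n, envelope d u / (1 - couplingFourier (algebraicCoupling d C₀ α) (fun i => u i / n)) ≤
      n ^ a / c' * ∫ u, envelopeRiesz d a u := by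
  set J := algebraicCoupling d C₀ α with hJdef
  have hpos := couplingNorm_algebraic_pos hd hC₀ hα
  have hs := algebraicCoupling_zero_summable hd hC₀.le hα
  have hJ0 : ∀ y, 0 ≤ J 0 y := fun y => algebraicCoupling_nonneg hC₀.le α 0 y
  have hgi := integrable_envelopeRiesz hd ha0 had
  have hB := measurableSet_momentumBox (d := d) n
  have h1 : ∫ u in momentumBox d n, envelope d u / (1 - couplingFourier J (fun i => u i / n)) ≤
      ∫ u in momentumBox d n, n ^ a / c' * envelopeRiesz d a u := by
    refine integral_mono_of_nonneg ?_ ((hgi.const_mul _).integrableOn) ?_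
    · exact ae_of_all _ fun p => div_nonneg (envelope_nonneg p) (one_sub_couplingFourier_nonneg J hJ0 hs hpos _)
    · exact (ae_restrict_iff' hB).2 (ae_of_all _ fun p hp =>
        div_gap_le hpos.ne' hc' hn hgap hp (envelope_nonneg p))
  have h2 : ∫ u in momentumBox d n, n ^ a / c' * envelopeRiesz d a u ≤ n ^ a / c' * ∫ u, envelopeRiesz d a u := by
    rw [integral_const_mul]
    refine mul_le_mul_of_nonneg_left ?_ (by positivity)
    exact setIntegral_le_integral hgi (ae_of_all _ (envelopeRiesz_nonneg a))
  exact h1.trans h2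

end DoubleSum

/-- `n/k ≤ 2⌊n/k⌋ + 1` (`k ≥ 1`), so `(n/k)^d ≤ |Λ_{⌊n/k⌋}|` (the case `k = d` is
`div_pow_le_card_box_div` of `…InfraredBoundFourier`). [folklore] -/
theorem div_pow_le_card_box_div_of_pos {k : ℕ} (hk : 1 ≤ k) (n : ℕ) :
    ((n : ℝ) / (k : ℝ)) ^ d ≤ #(box d (n / k)) := by
  rw [card_box]
  push_cast
  refine pow_le_pow_left₀ (by positivity) ?_ d
  have hk0 : (0 : ℝ) < k := by exact_mod_cast hk
  rw [div_le_iff₀ hk0]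
  have h1 : n < k * (n / k + 1) := by
    have := Nat.lt_div_mul_add (a := n) hk
    nlinarith [Nat.div_add_mod n k, Nat.mod_lt n hk]
  have h2 : (n : ℝ) ≤ k * (n / k + 1 : ℕ) := by exact_mod_cast h1.le
  push_cast at h2
  nlinarith [show (0 : ℝ) ≤ ((n / k : ℕ) : ℝ) from Nat.cast_nonneg _]

end LongRangeIsing

/-! ### Proposition 3.8's first display (kernel form) and the power-law bound, every `d ≥ 1` -/

section KernelForm

variable {d : ℕ} {C₀ α : ℝ}

/-- **Proposition 3.8's first display (kernel form) in every dimension `d ≥ 1`**, from Proposition 3.7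
(Fröhlich–Simon–Spencer constant), the ABF summability and MMS2, granted a cube gap bound with exponent
`a < d` (used only to make the majorant integrable): for `0 < β ≤ β_c` and `x ≠ 0`, `n = |x|_∞`,
`S_β(x) ≤ (K_d (2d)^{2d}/|J|)/(βn^d) ∫_{(-πn,πn]^d} W(u)/(1-Ĵ(u/n)) du`, `K_d = (9π²)^d/(2π)^d` — MMS2
averaged over `Λ_m`, `m = ⌊n/(2d)⌋` (`dm ≤ n`: `|Λ_m|S(x) ≤ χ_m`, the source's (eq. consequence mms) with
`C₁|x|^{-d}χ_{|x|}`), `|Λ_m|χ_m ≤ ∑_{Λ_n²}S(x-y)` (`2m ≤ n`), `sum_sum_pairCorrelation_le_of_gap`, the count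
`(n/(2d))^d ≤ |Λ_m|`, and `β = β_c` by left-continuity (the averaging scale `⌊n/(2d)⌋` rather than
`…InfraredBoundFourier`'s `⌊n/d⌋ ≤ ⌊n/2⌋` so that `d = 1` is covered).
[cite: Panis2023Triviality, proof of Proposition 3.8 (first display, eq. "consequence mms"), with Remark 3.9] -/
theorem pairCorrelation_le_kernelIntegral_of_gap (h37 : panis_prop37_infraredBound_fss)
    (habf : abf_pairCorrelation_summable) (hM : panis_mms_two_point_monotone)
    (hd : 1 ≤ d) (hC₀ : 0 < C₀) (hα : 0 < α) {a c' : ℝ} (had : a < d) (hc' : 0 < c')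
    (hgap : ∀ q : Fin d → ℝ, ‖q‖ ≤ Real.pi → c' * ‖q‖ ^ a ≤ 1 - couplingFourier (algebraicCoupling d C₀ α) q)
    {β : ℝ} (hβ : 0 < β) (hββc : β ≤ LongRangeIsing.criticalBeta (algebraicCoupling d C₀ α))
    {x : Site d} (hx : x ≠ 0) :
    pairCorrelation (algebraicCoupling d C₀ α) β 0 x ≤
      ((9 * Real.pi ^ 2) ^ d / (2 * Real.pi) ^ d * (2 * (d : ℝ)) ^ (2 * d) / couplingNorm (algebraicCoupling d C₀ α)) /
          (β * ‖x‖ ^ d) *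
        ∫ u in momentumBox d ‖x‖, envelope d u /
          (1 - couplingFourier (algebraicCoupling d C₀ α) (fun i => u i / ‖x‖)) := by
  set J := algebraicCoupling d C₀ α with hJdef
  have hpos := couplingNorm_algebraic_pos hd hC₀ hα
  have hJnn : ∀ x y, 0 ≤ J x y := algebraicCoupling_nonneg hC₀.le α
  set K : ℝ := (9 * Real.pi ^ 2) ^ d / (2 * Real.pi) ^ d with hKdef
  have hK : 0 < K := by positivity
  set C : ℝ := K * (2 * (d : ℝ)) ^ (2 * d) / couplingNorm J with hCdef
  have hC : 0 < C := by positivity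
  set n : ℕ := Site.supNorm x with hndef
  have hxn : ‖x‖ = n := Site.norm_eq_supNorm x
  have hn1 : 1 ≤ n := Nat.one_le_iff_ne_zero.2 fun h => hx (Site.supNorm_eq_zero_iff.1 h)
  have hn0 : (0 : ℝ) < n := by exact_mod_cast hn1
  rw [hxn]
  set I : ℝ := ∫ u in momentumBox d n, envelope d u / (1 - couplingFourier J (fun i => u i / n)) with hIdef
  -- the bound below `β_c`
  have hsub : ∀ β', 0 < β' → β' < LongRangeIsing.criticalBeta J →
      pairCorrelation J β' 0 x ≤ C / (β' * (n : ℝ) ^ d) * I := by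
    intro β' hβ' hβ'c
    have hmms : ∀ a b : Site d, (d : ℝ) * ‖a‖ ≤ ‖b‖ → pairCorrelation J β' 0 b ≤ pairCorrelation J β' 0 a :=
      hM d hd C₀ α hC₀ hα β' hβ'
    -- MMS averaging over `Λ_m`, `m = ⌊n/(2d)⌋` (`dm ≤ n`)
    set m : ℕ := n / (2 * d) with hmdef
    have hdm : d * m ≤ Site.supNorm x := by
      rw [← hndef, hmdef]
      calc d * (n / (2 * d)) ≤ 2 * d * (n / (2 * d)) := Nat.mul_le_mul_right _ (by omega)
        _ ≤ n := Nat.mul_div_le n (2 * d)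
    have h1 : (#(box d m) : ℝ) * pairCorrelation J β' 0 x ≤ boxSusceptibility J β' m :=
      card_box_mul_pairCorrelation_le_boxSusceptibility J β' hmms hdm
    -- the double sum over `Λ_n × Λ_n` (`2m ≤ n`)
    have h2m : 2 * m ≤ n := by
      have : m ≤ n / 2 := by
        rw [hmdef]
        exact Nat.div_le_div_left (by omega) two_pos
      omega
    have h3 : (#(box d m) : ℝ) * boxSusceptibility J β' m ≤
        ∑ a ∈ box d n, ∑ b ∈ box d n, pairCorrelation J β' 0 (a - b) :=
      card_box_mul_boxSusceptibility_le_sum_sum J β' hβ'.le hJnn h2m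
    have h4 := sum_sum_pairCorrelation_le_of_gap (d := d) h37 habf hd hC₀ hα had hc' hgap hβ' hβ'c hn1
    -- cardinality `(n/(2d))^d ≤ |Λ_m|`
    have hc2 : ((n : ℝ) / ((2 * d : ℕ) : ℝ)) ^ d ≤ #(box d m) := div_pow_le_card_box_div_of_pos (by omega) n
    have h2d0 : (0 : ℝ) < ((2 * d : ℕ) : ℝ) := by exact_mod_cast (show 0 < 2 * d by omega)
    have hq0 : (0 : ℝ) < ((n : ℝ) / ((2 * d : ℕ) : ℝ)) ^ d := by positivity
    have hcpos : (0 : ℝ) < #(box d m) := lt_of_lt_of_le hq0 hc2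
    -- combine: `|Λ_m|² S(x) ≤ K n^d/(β|J|) I`
    have h6 : (#(box d m) : ℝ) * ((#(box d m) : ℝ) * pairCorrelation J β' 0 x) ≤
        K * ((n : ℝ) ^ d / (β' * couplingNorm J)) * I :=
      (mul_le_mul_of_nonneg_left h1 hcpos.le).trans (h3.trans h4)
    have h7 : ((n : ℝ) / ((2 * d : ℕ) : ℝ)) ^ d * (((n : ℝ) / ((2 * d : ℕ) : ℝ)) ^ d * pairCorrelation J β' 0 x) ≤
        K * ((n : ℝ) ^ d / (β' * couplingNorm J)) * I := by
      refine le_trans ?_ h6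
      have hS := pairCorrelation_nonneg J β' hβ'.le hJnn 0 x
      exact mul_le_mul hc2 (mul_le_mul_of_nonneg_right hc2 hS) (by positivity) hcpos.le
    -- solve for `S(x)`
    have hnd : (0 : ℝ) < ((n : ℝ) / ((2 * d : ℕ) : ℝ)) ^ d * ((n : ℝ) / ((2 * d : ℕ) : ℝ)) ^ d := by positivity
    rw [← mul_assoc] at h7
    have h8 : pairCorrelation J β' 0 x ≤ K * ((n : ℝ) ^ d / (β' * couplingNorm J)) * I /
        (((n : ℝ) / ((2 * d : ℕ) : ℝ)) ^ d * ((n : ℝ) / ((2 * d : ℕ) : ℝ)) ^ d) :=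
      (le_div_iff₀' hnd).2 h7
    refine h8.trans (le_of_eq ?_)
    have hpow : ((n : ℝ) / ((2 * d : ℕ) : ℝ)) ^ d * ((n : ℝ) / ((2 * d : ℕ) : ℝ)) ^ d * (2 * (d : ℝ)) ^ (2 * d) =
        (n : ℝ) ^ d * (n : ℝ) ^ d := by
      rw [← mul_pow, ← mul_pow, pow_mul, ← mul_pow]
      congr 1
      push_cast
      field_simp
    rw [hCdef]
    field_simp
    have hpow' : (((n : ℝ) / ((2 * d : ℕ) : ℝ)) ^ d) ^ 2 * (2 * (d : ℝ)) ^ (2 * d) = ((n : ℝ) ^ d) ^ 2 := by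
      rw [sq, sq]; exact hpow
    rw [mul_assoc I, hpow']
    ring
  -- `β < β_c` or `β = β_c` (left-continuity)
  rcases hββc.lt_or_eq with hlt | heq
  · exact hsub β hβ hlt
  · have hβc : 0 < LongRangeIsing.criticalBeta J := hβ.trans_le hββc
    rw [heq]
    have hlim := tendsto_pairCorrelation_nhdsLT J hJnn hβc (0 : Site d) x
    have hR : Tendsto (fun β' : ℝ => C / (β' * (n : ℝ) ^ d) * I) (𝓝[<] LongRangeIsing.criticalBeta J)
        (𝓝 (C / (LongRangeIsing.criticalBeta J * (n : ℝ) ^ d) * I)) := by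
      refine (ContinuousAt.tendsto ?_).mono_left nhdsWithin_le_nhds
      refine ((continuousAt_const.div (continuousAt_id.mul continuousAt_const) ?_).mul continuousAt_const)
      exact mul_ne_zero hβc.ne' (pow_ne_zero _ hn0.ne')
    refine le_of_tendsto_of_tendsto hlim hR ?_
    filter_upwards [Ioo_mem_nhdsLT hβc] with β' hβ'
    exact hsub β' hβ'.1 hβ'.2

/-- **`⟨σ₀σ_x⟩_β ≤ C/(β|x|^{d-a})` for `0 < β ≤ β_c`, `x ≠ 0`, in every `d ≥ 1`, granted a cube gap bound
`1 - Ĵ(q) ≥ c'‖q‖^a` with `0 ≤ a < d`** (the kernel form, then `∫_{(-πn,πn]^d}W/(1-Ĵ(u/n)) ≤ (n^a/c')∫W‖u‖^{-a}`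
— the step "the decay of the two-point function is governed by the behaviour of `1 - Ĵ(p)` as `p` goes
to `0`" with Remark 3.9's local integrability of `‖p‖^{-a}`, `a < d`).
[cite: Panis2023Triviality, §3.3, display for algebraic decay interactions (before Remark 3.9) and Remark 3.9] -/
theorem pairCorrelation_le_rpow_of_gap (h37 : panis_prop37_infraredBound_fss)
    (habf : abf_pairCorrelation_summable) (hM : panis_mms_two_point_monotone)
    (hd : 1 ≤ d) (hC₀ : 0 < C₀) (hα : 0 < α) {a c' : ℝ} (ha0 : 0 ≤ a) (had : a < d) (hc' : 0 < c')
    (hgap : ∀ q : Fin d → ℝ, ‖q‖ ≤ Real.pi → c' * ‖q‖ ^ a ≤ 1 - couplingFourier (algebraicCoupling d C₀ α) q) :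
    ∃ C : ℝ, 0 < C ∧ ∀ (β : ℝ), 0 < β → β ≤ LongRangeIsing.criticalBeta (algebraicCoupling d C₀ α) →
      ∀ (x : Site d), x ≠ 0 →
        pairCorrelation (algebraicCoupling d C₀ α) β 0 x ≤ C / (β * ‖x‖ ^ ((d : ℝ) - a)) := by
  set J := algebraicCoupling d C₀ α with hJdef
  have hpos := couplingNorm_algebraic_pos hd hC₀ hα
  set C₁ : ℝ := (9 * Real.pi ^ 2) ^ d / (2 * Real.pi) ^ d * (2 * (d : ℝ)) ^ (2 * d) / couplingNorm J with hC₁def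
  have hC₁ : 0 < C₁ := by positivity
  set K : ℝ := ∫ u, envelopeRiesz d a u with hKdef
  have hK0 : 0 ≤ K := integral_nonneg (envelopeRiesz_nonneg a)
  refine ⟨C₁ * (K / c' + 1), by positivity, fun β hβ hββc x hx => ?_⟩
  have hn1 : 1 ≤ ‖x‖ := one_le_norm_of_ne_zero hx
  have hn0 : 0 < ‖x‖ := by linarith
  have hker := pairCorrelation_le_kernelIntegral_of_gap h37 habf hM hd hC₀ hα had hc' hgap hβ hββc hx
  have hint := kernelIntegral_le_of_gap (d := d) hd hC₀ hα ha0 had hc' hgap hn0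
  calc pairCorrelation J β 0 x
      ≤ C₁ / (β * ‖x‖ ^ d) *
          ∫ u in momentumBox d ‖x‖, envelope d u / (1 - couplingFourier J (fun i => u i / ‖x‖)) := hker
    _ ≤ C₁ / (β * ‖x‖ ^ d) * (‖x‖ ^ a / c' * K) := mul_le_mul_of_nonneg_left hint (by positivity)
    _ = C₁ * (K / c') / (β * ‖x‖ ^ ((d : ℝ) - a)) := by
        rw [Real.rpow_sub hn0, Real.rpow_natCast]
        field_simp
    _ ≤ C₁ * (K / c' + 1) / (β * ‖x‖ ^ ((d : ℝ) - a)) := by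
        gcongr
        linarith

end KernelForm

/-! ### The headline: Remark 3.9 (`d = 2`, `α < 2`; `d = 1`, `α < 1`) -/

/-- **`panis_infraredBound_algebraic_lowDim` from Proposition 3.7 (Fröhlich–Simon–Spencer constant), the
ABF summability and MMS2**: in both cases `α < 2`, so the discharged gap bound `exists_cube_gap_lower`
gives `1 - Ĵ(q) ≥ c'‖q‖^α` on the cube, and `α < d` is Remark 3.9's local integrability condition;
`pairCorrelation_le_rpow_of_gap` with `a = α` is the display with `1/β` kept.
[cite: Panis2023Triviality, §3.3, first display of p. 16 (case α ∈ (0,2)) and Remark 3.9] -/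
theorem panis_infraredBound_algebraic_lowDim_of_prop37_mms (h37 : panis_prop37_infraredBound_fss)
    (habf : abf_pairCorrelation_summable) (hM : panis_mms_two_point_monotone) :
    panis_infraredBound_algebraic_lowDim := by
  intro d α hcase C₀ hC₀ hα
  have hd : 1 ≤ d := by rcases hcase with ⟨rfl, -⟩ | ⟨rfl, -⟩ <;> norm_num
  have hα2 : α < 2 := by rcases hcase with ⟨-, h⟩ | ⟨-, h⟩ <;> linarith
  have hαd : α < d := by
    rcases hcase with ⟨rfl, h⟩ | ⟨rfl, h⟩ <;> push_cast <;> linarith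
  obtain ⟨c', hc', hgap⟩ := exists_cube_gap_lower hd hC₀ hα hα2.ne
  rw [min_eq_left hα2.le] at hgap
  exact pairCorrelation_le_rpow_of_gap h37 habf hM hd hC₀ hα hα.le hαd hc' hgap

/-- **HEADLINE — the vendored fact `panis_infraredBound_algebraic_lowDim` (Panis 2023, §3.3 p. 16 with
Remark 3.9) from Proposition 3.7 (Fröhlich–Simon–Spencer constant) and the ABF finiteness of the
susceptibility below `β_c`**, MMS2 being the tree's theorem `panis_mms_two_point_monotone_holds`.
[cite: Panis2023Triviality, §3.3, first display of p. 16 (case α ∈ (0,2)) and Remark 3.9] -/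
theorem panis_infraredBound_algebraic_lowDim_of_prop37 (h37 : panis_prop37_infraredBound_fss)
    (habf : abf_pairCorrelation_summable) : panis_infraredBound_algebraic_lowDim :=
  panis_infraredBound_algebraic_lowDim_of_prop37_mms h37 habf panis_mms_two_point_monotone_holds

/-- The same from the tree's printed-constant fact `panis_prop37_infraredBound` (which implies the
Fröhlich–Simon–Spencer form). [cite: Panis2023Triviality, §3.3, first display of p. 16 and Remark 3.9, with Proposition 3.7] -/
theorem panis_infraredBound_algebraic_lowDim_of_prop37' (h37 : panis_prop37_infraredBound)
    (habf : abf_pairCorrelation_summable) : panis_infraredBound_algebraic_lowDim :=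
  panis_infraredBound_algebraic_lowDim_of_prop37 (panis_prop37_infraredBound_fss_of_printed h37) habf

/-! ### By-products in `d ≥ 3`: Proposition 3.8 (kernel form and (IRB)) and the `§3.6` bound from the
Fröhlich–Simon–Spencer form of Proposition 3.7 -/

/-- **`panis_prop38_kernelForm` (`d ≥ 3`) from Proposition 3.7 (Fröhlich–Simon–Spencer constant), the ABF
summability and MMS2** (gap exponent `a = 2` from the nearest-neighbour bound
`sq_le_one_sub_couplingFourier_algebraic`, `2 < 3 ≤ d`). [cite: Panis2023Triviality, proof of Proposition 3.8] -/
theorem panis_prop38_kernelForm_of_prop37_fss (h37 : panis_prop37_infraredBound_fss)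
    (habf : abf_pairCorrelation_summable) (hM : panis_mms_two_point_monotone) : panis_prop38_kernelForm := by
  intro d hd C₀ α hC₀ hα
  have hd1 : 1 ≤ d := by omega
  obtain ⟨c₁, hc₁, hnn⟩ := sq_le_one_sub_couplingFourier_algebraic hd1 hC₀ hα
  have hgap : ∀ q : Fin d → ℝ, ‖q‖ ≤ Real.pi →
      c₁ * ‖q‖ ^ (2 : ℝ) ≤ 1 - couplingFourier (algebraicCoupling d C₀ α) q := fun q hq => by
    rw [Real.rpow_two]; exact hnn q hq
  have h2d : (2 : ℝ) < d := by exact_mod_cast (show 2 < d by omega)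
  refine ⟨(9 * Real.pi ^ 2) ^ d / (2 * Real.pi) ^ d * (2 * (d : ℝ)) ^ (2 * d) / couplingNorm (algebraicCoupling d C₀ α),
    by have := couplingNorm_algebraic_pos hd1 hC₀ hα; positivity, fun β hβ hββc x hx => ?_⟩
  exact pairCorrelation_le_kernelIntegral_of_gap h37 habf hM hd1 hC₀ hα h2d hc₁ hgap hβ hββc hx

/-- **`panis_infraredBound_algebraic_beta` (`d ≥ 3`, `α ≠ 2`, factor `1/β`) from Proposition 3.7
(Fröhlich–Simon–Spencer constant), the ABF summability and MMS2** (`a = α∧2 ≤ 2 < d`, gap bound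
`exists_cube_gap_lower`). [cite: Panis2023Triviality, §3.3, display for algebraic decay interactions (before Remark 3.9)] -/
theorem panis_infraredBound_algebraic_beta_of_prop37_fss (h37 : panis_prop37_infraredBound_fss)
    (habf : abf_pairCorrelation_summable) (hM : panis_mms_two_point_monotone) :
    panis_infraredBound_algebraic_beta := by
  intro d hd C₀ α hC₀ hα hα2
  have hd1 : 1 ≤ d := by omega
  obtain ⟨c', hc', hgap⟩ := exists_cube_gap_lower hd1 hC₀ hα hα2
  have ha0 : 0 ≤ min α 2 := le_min hα.le zero_le_two
  have had : min α 2 < d := by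
    have h3 : (3 : ℝ) ≤ d := by exact_mod_cast hd
    linarith [min_le_right α 2]
  exact pairCorrelation_le_rpow_of_gap h37 habf hM hd1 hC₀ hα ha0 had hc' hgap

/-- **`panis_infraredBound_algebraic` (`§3.6`, `d ≥ 3`, `α ≠ 2`) from Proposition 3.7 (Fröhlich–Simon–Spencer
constant) and the ABF summability** (through `panis_infraredBound_algebraic_of_beta` of `…InfraredBound`,
MMS2 being the tree's theorem). [cite: Panis2023Triviality, §3.6 (last display of p. 16) with Propositions 3.7, 3.8] -/
theorem panis_infraredBound_algebraic_of_prop37_fss (h37 : panis_prop37_infraredBound_fss)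
    (habf : abf_pairCorrelation_summable) : panis_infraredBound_algebraic :=
  panis_infraredBound_algebraic_of_beta
    (panis_infraredBound_algebraic_beta_of_prop37_fss h37 habf panis_mms_two_point_monotone_holds)

/-- **`panis_infraredBound_rp` — Proposition 3.8, display (IRB), `d ≥ 3`, every `α > 0` — from
Proposition 3.7 (Fröhlich–Simon–Spencer constant), the ABF summability and MMS2**: with the
nearest-neighbour gap bound (`a = 2 < d`) `pairCorrelation_le_rpow_of_gap` gives
`S_β(x) ≤ C/(β|x|^{d-2})` for `0 < β ≤ β_c`; then `S_β(x) ≤ S_{β_c}(x) ≤ C/(β_c|x|^{d-2})` by Griffiths'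
monotonicity in `β` (`state_spinProduct_mono_beta`), the factor `1/β_c` being absorbed (if `β_c = 0` the
range of `β` is empty). [cite: Panis2023Triviality, Proposition 3.8, display (IRB) (S_{ρ,β}(x) ≤ S_{ρ,β_c(ρ)}(x) ≤ C/(β_c(ρ)|J||x|^{d-2}))] -/
theorem panis_infraredBound_rp_of_prop37_mms (h37 : panis_prop37_infraredBound_fss)
    (habf : abf_pairCorrelation_summable) (hM : panis_mms_two_point_monotone) : panis_infraredBound_rp := by
  intro d hd C₀ α hC₀ hα
  have hd1 : 1 ≤ d := by omega
  set J := algebraicCoupling d C₀ α with hJdef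
  obtain ⟨c₁, hc₁, hnn⟩ := sq_le_one_sub_couplingFourier_algebraic hd1 hC₀ hα
  have hgap : ∀ q : Fin d → ℝ, ‖q‖ ≤ Real.pi → c₁ * ‖q‖ ^ (2 : ℝ) ≤ 1 - couplingFourier J q := fun q hq => by
    rw [Real.rpow_two]; exact hnn q hq
  have h2d : (2 : ℝ) < d := by exact_mod_cast (show 2 < d by omega)
  obtain ⟨C, hC, hb⟩ := pairCorrelation_le_rpow_of_gap h37 habf hM hd1 hC₀ hα zero_le_two h2d hc₁ hgap
  by_cases hβc : 0 < LongRangeIsing.criticalBeta J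
  · refine ⟨C / LongRangeIsing.criticalBeta J, div_pos hC hβc, fun β hβ hββc x hx => ?_⟩
    calc pairCorrelation J β 0 x ≤ pairCorrelation J (LongRangeIsing.criticalBeta J) 0 x := by
          rw [pairCorrelation_eq, pairCorrelation_eq]
          exact state_spinProduct_mono_beta _ (algebraicCoupling_nonneg hC₀.le α) hβ.le hββc _
      _ ≤ C / (LongRangeIsing.criticalBeta J * ‖x‖ ^ ((d : ℝ) - 2)) := hb _ hβc le_rfl x hx
      _ = C / LongRangeIsing.criticalBeta J / ‖x‖ ^ ((d : ℝ) - 2) := by rw [div_div]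
  · exact ⟨1, one_pos, fun β hβ hββc x hx => absurd (hβ.trans_le hββc) hβc⟩

/-- **`panis_infraredBound_rp` from Proposition 3.7 (Fröhlich–Simon–Spencer constant) and the ABF
summability**, MMS2 being the tree's theorem. [cite: Panis2023Triviality, Proposition 3.8, display (IRB)] -/
theorem panis_infraredBound_rp_of_prop37_fss (h37 : panis_prop37_infraredBound_fss)
    (habf : abf_pairCorrelation_summable) : panis_infraredBound_rp :=
  panis_infraredBound_rp_of_prop37_mms h37 habf panis_mms_two_point_monotone_holds

/-! ### Consequence: `panis_ursellFourBoxSum_le` and Theorem 1.2 in every `d ≥ 1` from the tree diagram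
bound, the moment display, and the two infrared inputs -/

/-- **Panis's bound on `S(β,L,f)` in every `d ≥ 1` from the tree diagram bound, Proposition 3.7
(Fröhlich–Simon–Spencer constant) and the ABF summability** — the three printed infrared bounds entering
`panis_ursellFourBoxSum_le_of_facts` (`…InputsProofs`) all follow from these two inputs.
[cite: Panis2023Triviality, proof of Theorem 5.5 (p. 22), with Propositions 3.7, 3.8, Remark 3.9 and §3.6] -/
theorem panis_ursellFourBoxSum_le_of_prop37_fss (hT : panis_treeDiagramBound)
    (h37 : panis_prop37_infraredBound_fss) (habf : abf_pairCorrelation_summable) : panis_ursellFourBoxSum_le :=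
  panis_ursellFourBoxSum_le_of_facts hT (panis_infraredBound_algebraic_of_prop37_fss h37 habf)
    (panis_infraredBound_rp_of_prop37_fss h37 habf) (panis_infraredBound_algebraic_lowDim_of_prop37 h37 habf)

/-- **Theorem 1.2 (all `d ≥ 1`) from the moment-generating-function display, the tree diagram bound,
Proposition 3.7 (Fröhlich–Simon–Spencer constant) and the ABF summability.**
[cite: Panis2023Triviality, Theorem 1.2 and proof of Theorem 5.5 (pp. 21–22)] -/
theorem panis_thm12_of_prop37_fss (hMgf : panis_mgfDeviation_le_ursellFourBoxSum) (hT : panis_treeDiagramBound)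
    (h37 : panis_prop37_infraredBound_fss) (habf : abf_pairCorrelation_summable) : panis_thm12 :=
  panis_thm12_of_inputs hMgf (panis_ursellFourBoxSum_le_of_prop37_fss hT h37 habf)

end Literature.Barriers.CriticalPhenomena

end
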